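import Mathlib.MeasureTheory.Measure.Dirac
import Mathlib.MeasureTheory.Measure.Real
import Mathlib.Combinatorics.SimpleGraph.Connectivity.Connected
import Mathlib.Combinatorics.SimpleGraph.Finite
import Mathlib.Analysis.SpecialFunctions.Exp
import Mathlib.Order.UpperLower.Basic
import Mathlib.Data.ENNReal.BigOperators
import Literature.Probability.Percolation.Percolation
import Literature.Probability.Percolation.PercolationEvents
import Literature.Probability.LatticeModels.IsingModel
import Literature.Probability.LatticeModels.DomainDiscretisation
import HarnessLib

-- provenance: harness21/H21/H21/Prelude/StatMech/RandomCluster.lean @ 93aad00 (interim HEAD d8f2665); M5 mechanical rewrite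
/-!
# The FK random-cluster model (StatMech trunk, prelude P22)

Part 1 of the notion `fk_ising_fermionic_observable`: the Fortuin–Kasteleyn random-cluster
measure `φ_{G,p,q}^B` of a finite graph `G` with a *wired* vertex set `B` (all vertices of `B`
identified, i.e. counted as a single cluster), the Edwards–Sokal identity relating the `q = 2`
model to the Ising two-point function, and the planar/Dobrushin set-up `fkDomainMeasure` on the
discretisation `Ω_δ` of a complex domain with a wired boundary arc.

## Main definitions

* `Literature.StatMech.wired B`: the complete graph on `B ⊆ V` (as a `SimpleGraph V`), used to wire a
  boundary set.
* `Literature.StatMech.clusterCount ω B`: the number `k(ω)` of connected components of the open graph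
  of `ω` with `B` wired.
* `Literature.StatMech.rcWeight G p q B ω = p^{|ω|} (1-p)^{|E \ ω|} q^{k^B(ω)}`,
  `Literature.Probability.LatticeModels.rcPartitionFunction` (its sum `Z`), `Literature.StatMech.rcMeasure G p q B` (the
  probability measure on `BondConfig V = Set (Sym2 V)`, an explicit finite sum of Diracs).
* `Literature.StatMech.fkIsingParam β = 1 - e^{-2β}` and `Literature.StatMech.fkDomainMeasure Ω δ p q A`, the
  random-cluster measure of `discreteDomainGraph Ω δ` wired on the discrete arc
  `discreteArc Ω δ A`, as a measure on `BondConfig (Site 2)`.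

## Main statements (proofs `sorry`, known in print)

* `rcMeasure_one_eq_bondPercolation`: `q = 1` is Bernoulli bond percolation.
* `rcMeasure_fkg`: FKG inequality for `q ≥ 1`.
* `edwardsSokal_twoPoint`: `⟨σ_x σ_y⟩^{free}_{G,β} = φ_{G,1-e^{-2β},2}(x ↔ y)`.

## Design notes

* Mathlib has no random-cluster model (grep `random.cluster`, `Edwards`, `Fortuin`: nothing); it
  has `SimpleGraph.ConnectedComponent`, `SimpleGraph.edgeFinset`, `Measure.dirac`, which we use.
* The measure is an explicit finite sum `∑_ω (w(ω)/Z) δ_ω` and *not* `Measure.tilted`, because the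
  weight is not `exp` of a real function at `p ∈ {0, 1}` (Outline §0, "Gibbs weights").
* `IsProbabilityMeasure (rcMeasure G p q B)` only holds for `0 ≤ p ≤ 1`, `0 < q`; it is the
  *theorem* `isProbabilityMeasure_rcMeasure` (real proof), not an instance.
* The number of closed edges is `#(G.edgeFinset \ ω)` (no `ℕ` subtraction); for
  `ω ⊆ G.edgeFinset` this is `|E| - |ω|`.
* `fkDomainMeasure` works on the finite subtype `↥(meshDomain Ω δ)` (a `[Fintype _]` argument,
  available from `meshDomain_finite` for bounded `Ω`, `δ > 0`) and pushes configurations forward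
  to `BondConfig (Site 2)` by the explicit image `Sym2.map Subtype.val '' ω` inside the sum of
  Diracs (no `Measure.map`, hence no measurability junk).

## References

* G. Grimmett, *The Random-Cluster Model*, Springer 2006, §§1.2–1.4, Thm. 1.10 (Edwards–Sokal
  coupling), Thm. 1.16 (coupling with wired boundary), Thm. 3.8 (FKG).
* R. G. Edwards, A. D. Sokal, *Generalization of the Fortuin–Kasteleyn–Swendsen–Wang
  representation and Monte Carlo algorithm*, Phys. Rev. D 38 (1988).
* S. Smirnov, *Conformal invariance in random cluster models. I*, Ann. Math. 172 (2010), §2.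
-/

namespace Literature.Probability.LatticeModels

open MeasureTheory Finset
open scoped ENNReal

/-! ### Wired boundary sets and cluster counts -/

section Wired

variable {V : Type*}

/-- The wiring graph of a vertex set `B`: the complete graph on `B` (and no other edges), built
with `SimpleGraph.fromRel`. Joining it to an open graph identifies all vertices of `B` into one
cluster (wired boundary condition; Grimmett 2006, §1.2 and §4.2). [cite: Grimmett2006, §1.2 and §4.2] -/
def wired (B : Set V) : SimpleGraph V :=
  SimpleGraph.fromRel fun x y => x ∈ B ∧ y ∈ B

/-- Adjacency in the wiring graph (Grimmett 2006, §1.2). [cite: Grimmett2006, §1.2] -/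
@[simp] theorem wired_adj (B : Set V) (x y : V) :
    (wired B).Adj x y ↔ x ≠ y ∧ x ∈ B ∧ y ∈ B := by
  simp only [wired, SimpleGraph.fromRel_adj, ne_eq, and_congr_right_iff]
  intro; constructor
  · rintro (h | h) <;> tauto
  · tauto

/-- Wiring the empty set does nothing: free boundary condition (Grimmett 2006, §1.2). [cite: Grimmett2006, §1.2] -/
@[simp] theorem wired_empty : wired (∅ : Set V) = ⊥ := by
  ext x y; simp

/-- The number of open clusters `k^B(ω)` of the configuration `ω` with the set `B` wired: the
number of connected components of `openGraph ω ⊔ wired B` (so all of `B` counts as one cluster,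
and `B = ∅` is the free count `k(ω)`). `Nat.card`, hence `0` (junk) if there are infinitely
many components. (Grimmett 2006, §1.2, eq. (1.1); §4.2 for the wired count.) [cite: Grimmett2006, §1.2  eq. (1.1] -/
noncomputable def clusterCount (ω : Percolation.BondConfig V) (B : Set V) : ℕ :=
  Nat.card (Percolation.openGraph ω ⊔ wired B).ConnectedComponent

end Wired

/-! ### The random-cluster measure of a finite graph -/

section Finite

variable {V : Type*} [Fintype V] [DecidableEq V] (G : SimpleGraph V) [DecidableRel G.Adj]

/-- The random-cluster weight of an edge set `ω` on the finite graph `G` with parameters `p, q`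
and wired set `B`: `p^{|ω|} (1 - p)^{|E(G) \ ω|} q^{k^B(ω)}` (Grimmett 2006, §1.2, eq. (1.2)).
Intended for `ω ⊆ G.edgeFinset`. [cite: Grimmett2006, §1.2  eq. (1.2] -/
noncomputable def rcWeight (p q : ℝ) (B : Set V) (ω : Finset (Sym2 V)) : ℝ :=
  p ^ #ω * (1 - p) ^ #(G.edgeFinset \ ω) * q ^ clusterCount (↑ω : Percolation.BondConfig V) B

/-- Random-cluster weights are nonnegative for `0 ≤ p ≤ 1`, `0 ≤ q` (Grimmett 2006, §1.2). [cite: Grimmett2006, §1.2] -/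
theorem rcWeight_nonneg {p q : ℝ} (hp : p ∈ Set.Icc (0 : ℝ) 1) (hq : 0 ≤ q) (B : Set V)
    (ω : Finset (Sym2 V)) : 0 ≤ rcWeight G p q B ω := by
  have h1 : 0 ≤ 1 - p := sub_nonneg.2 hp.2
  have h0 : 0 ≤ p := hp.1
  unfold rcWeight
  positivity

/-- The random-cluster partition function
`Z^B_{G,p,q} = ∑_{ω ⊆ E(G)} p^{|ω|} (1 - p)^{|E \ ω|} q^{k^B(ω)}` (Grimmett 2006, §1.2,
eq. (1.3)). [cite: Grimmett2006, §1.2  eq. (1.3] -/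
noncomputable def rcPartitionFunction (p q : ℝ) (B : Set V) : ℝ :=
  ∑ ω ∈ G.edgeFinset.powerset, rcWeight G p q B ω

/-- The partition function is positive for `0 ≤ p ≤ 1` and `0 < q` (the all-closed, resp.
all-open, configuration has positive weight when `p = 0`, resp. `p > 0`) (Grimmett 2006, §1.2). [cite: Grimmett2006, §1.2] -/
theorem rcPartitionFunction_pos {p q : ℝ} (hp : p ∈ Set.Icc (0 : ℝ) 1) (hq : 0 < q)
    (B : Set V) : 0 < rcPartitionFunction G p q B := by
  refine Finset.sum_pos' (fun ω _ => rcWeight_nonneg G hp hq.le B ω) ?_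
  rcases hp.1.eq_or_lt with h | h
  · refine ⟨∅, Finset.empty_mem_powerset _, ?_⟩
    subst h
    simp only [rcWeight, card_empty, pow_zero, sub_zero, one_pow, one_mul]
    positivity
  · refine ⟨G.edgeFinset, Finset.mem_powerset_self _, ?_⟩
    simp only [rcWeight, sdiff_self, Finset.bot_eq_empty, card_empty, pow_zero, mul_one]
    positivity

/-- The random-cluster measure `φ^B_{G,p,q}` on bond configurations of the finite graph `G`,
with wired set `B`: the explicit finite sum `∑_{ω ⊆ E(G)} (w(ω)/Z) δ_ω` of Dirac masses
(Grimmett 2006, §1.2, eq. (1.2); wired sets §4.2). A probability measure for `0 ≤ p ≤ 1`,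
`0 < q` (`isProbabilityMeasure_rcMeasure`); junk otherwise. [cite: Grimmett2006, §1.2  eq. (1.2] -/
noncomputable def rcMeasure (p q : ℝ) (B : Set V) : Measure (Percolation.BondConfig V) :=
  ∑ ω ∈ G.edgeFinset.powerset,
    ENNReal.ofReal (rcWeight G p q B ω / rcPartitionFunction G p q B) •
      Measure.dirac (↑ω : Percolation.BondConfig V)

/-- For `0 ≤ p ≤ 1` and `0 < q` the random-cluster measure is a probability measure: the masses
`w(ω)/Z` sum to `1` (Grimmett 2006, §1.2). [cite: Grimmett2006, §1.2] -/
theorem isProbabilityMeasure_rcMeasure {p q : ℝ} (hp : p ∈ Set.Icc (0 : ℝ) 1) (hq : 0 < q)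
    (B : Set V) : IsProbabilityMeasure (rcMeasure G p q B) := by
  constructor
  have hZ := rcPartitionFunction_pos G hp hq B
  simp only [rcMeasure, Measure.coe_finsetSum, Measure.coe_smul, Finset.sum_apply,
    Pi.smul_apply, measure_univ, smul_eq_mul, mul_one]
  rw [← ENNReal.ofReal_sum_of_nonneg
    (fun ω _ => div_nonneg (rcWeight_nonneg G hp hq.le B ω) hZ.le),
    ← Finset.sum_div, ← rcPartitionFunction, div_self hZ.ne', ENNReal.ofReal_one]

/-- At `q = 1` the random-cluster measure is Bernoulli bond percolation with density `p`
(Grimmett 2006, §1.3, "p. 6: when q = 1 this is the product measure"). [cite: Grimmett2006, §1.3  "p. 6: when q = 1 this is the prod] -/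
def rcMeasure_one_eq_bondPercolation : Prop :=
  ∀ {p : ℝ} (hp : p ∈ Set.Icc (0 : ℝ) 1) (B : Set V),
    rcMeasure G p 1 B = Percolation.bondPercolation G (Set.projIcc (0 : ℝ) 1 zero_le_one p)

/-- **FKG inequality** for the random-cluster model: for `0 ≤ p ≤ 1` and `q ≥ 1`, increasing
events (Mathlib `IsUpperSet` for the inclusion order on `Set (Sym2 V)`) are positively
correlated, `φ(A ∩ A') ≥ φ(A) φ(A')` (Fortuin–Kasteleyn–Ginibre 1971; Grimmett 2006, Thm. 3.8). [cite: FortuinKasteleynGinibre1971] -/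
def rcMeasure_fkg : Prop :=
  ∀ {p q : ℝ} (hp : p ∈ Set.Icc (0 : ℝ) 1) (hq : 1 ≤ q) (B : Set V) {A A' : Set (Percolation.BondConfig V)} (hA : IsUpperSet A) (hA' : IsUpperSet A'),
    (rcMeasure G p q B).real A * (rcMeasure G p q B).real A' ≤
      (rcMeasure G p q B).real (A ∩ A')

/-- The FK–Ising parameter `p = 1 - e^{-2β}` corresponding to inverse temperature `β` for the
Hamiltonian `-∑ σ_x σ_y` (Edwards–Sokal 1988; Grimmett 2006, Thm. 1.10 with `J = 1`, spins
`±1`). [cite: EdwardsSokal1988] -/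
noncomputable def fkIsingParam (β : ℝ) : ℝ := 1 - Real.exp (-2 * β)

/-- `fkIsingParam β ∈ [0, 1]` for `β ≥ 0` (Grimmett 2006, §1.4). [cite: Grimmett2006, §1.4] -/
theorem fkIsingParam_mem_Icc {β : ℝ} (hβ : 0 ≤ β) : fkIsingParam β ∈ Set.Icc (0 : ℝ) 1 := by
  refine ⟨sub_nonneg.2 (Real.exp_le_one_iff.2 (by linarith)), ?_⟩
  have := Real.exp_pos (-2 * β)
  simp only [fkIsingParam]; linarith

/-- **Edwards–Sokal identity** for the two-point function: for the free-boundary Ising model on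
the finite graph `G` at inverse temperature `β ≥ 0` and zero field,
`⟨σ_x σ_y⟩ = φ_{G, 1 - e^{-2β}, 2}(x ↔ y)` (free random-cluster measure, `B = ∅`). Both sides
equal `1` at `x = y` (Edwards–Sokal 1988; Grimmett 2006, Thm. 1.16). [cite: EdwardsSokal1988] -/
def edwardsSokal_twoPoint : Prop :=
  ∀ {β : ℝ} (hβ : 0 ≤ β) (x y : V),
    isingTwoPoint G univ β 0 .free x y =
      (rcMeasure G (1 - Real.exp (-2 * β)) 2 ∅).real (Percolation.openConn x y)

end Finite

/-! ### The planar (Dobrushin) set-up on a discretised domain -/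

section Planar

open scoped Classical in
/-- The graph `Ω_δ` as a graph on the (finite) vertex type `↥(meshDomain Ω δ)`:
`discreteDomainGraph Ω δ` pulled back along the inclusion (Smirnov 2010, §2;
Chelkak–Smirnov 2012, §1.2). [cite: Smirnov2010, §2] -/
noncomputable def domainSubgraph (Ω : Set ℂ) (δ : ℝ) : SimpleGraph (meshDomain Ω δ) :=
  (discreteDomainGraph Ω δ).comap Subtype.val

/-- Lift a bond configuration of the subtype graph `Ω_δ` to a bond configuration of `Site 2`
(image under `Sym2.map Subtype.val`). (Smirnov 2010, §2.) [cite: Smirnov2010, §2] -/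
def liftConfig (Ω : Set ℂ) (δ : ℝ) (ω : Finset (Sym2 (meshDomain Ω δ))) : Percolation.BondConfig (Site 2) :=
  Sym2.map Subtype.val '' (↑ω : Set (Sym2 (meshDomain Ω δ)))

open scoped Classical in
/-- The FK random-cluster measure `φ^{A}_{Ω_δ,p,q}` of the discretised domain `Ω_δ =
discreteDomainGraph Ω δ` (finite: `[Fintype ↥(meshDomain Ω δ)]`, provided by `meshDomain_finite`
for bounded `Ω` and `δ > 0`), wired on the discrete boundary arc `discreteArc Ω δ A` and free
elsewhere (Dobrushin boundary conditions), as a measure on `BondConfig (Site 2)`: the finite sum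
`∑_{ω ⊆ E(Ω_δ)} (w(ω)/Z) δ_{ι(ω)}` with `ι = liftConfig`. A probability measure for
`0 ≤ p ≤ 1`, `0 < q`. (Smirnov 2010, §2; Grimmett 2006, §1.2, §4.2; the FK–Ising case is
`p = fkIsingParam β`, `q = 2`.) [cite: Smirnov2010, §2] -/
noncomputable def fkDomainMeasure (Ω : Set ℂ) (δ p q : ℝ) (A : Set ℂ)
    [Fintype (meshDomain Ω δ)] : Measure (Percolation.BondConfig (Site 2)) :=
  ∑ ω ∈ (domainSubgraph Ω δ).edgeFinset.powerset,
    ENNReal.ofReal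
        (rcWeight (domainSubgraph Ω δ) p q (Subtype.val ⁻¹' discreteArc Ω δ A) ω /
          rcPartitionFunction (domainSubgraph Ω δ) p q (Subtype.val ⁻¹' discreteArc Ω δ A)) •
      Measure.dirac (liftConfig Ω δ ω)

/-- For `0 ≤ p ≤ 1` and `0 < q` the domain random-cluster measure is a probability measure
(Grimmett 2006, §1.2). [cite: Grimmett2006, §1.2] -/
theorem isProbabilityMeasure_fkDomainMeasure (Ω : Set ℂ) (δ : ℝ) {p q : ℝ}
    (hp : p ∈ Set.Icc (0 : ℝ) 1) (hq : 0 < q) (A : Set ℂ) [Fintype (meshDomain Ω δ)] :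
    IsProbabilityMeasure (fkDomainMeasure Ω δ p q A) := by
  classical
  constructor
  have hZ := rcPartitionFunction_pos (domainSubgraph Ω δ) hp hq
    (Subtype.val ⁻¹' discreteArc Ω δ A)
  simp only [fkDomainMeasure, Measure.coe_finsetSum, Measure.coe_smul, Finset.sum_apply,
    Pi.smul_apply, measure_univ, smul_eq_mul, mul_one]
  rw [← ENNReal.ofReal_sum_of_nonneg
    (fun ω _ => div_nonneg (rcWeight_nonneg _ hp hq.le _ ω) hZ.le),
    ← Finset.sum_div, ← rcPartitionFunction, div_self hZ.ne', ENNReal.ofReal_one]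

end Planar

end Literature.Probability.LatticeModels
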